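import Mathlib

/-!
# Stub `stub_coeffInvBound` for line `Sketch-ideate-r1-k1` (crux stmt-Langlands-8485)

Over a nonarchimedean normed field, a power series with constant coefficient `1` and all
coefficients of norm `≤ 1` has an inverse (Mathlib's `PowerSeries` inverse over a field) all of
whose coefficients have norm `≤ 1`.  Proof: the recursion `PowerSeries.coeff_inv`, strong
induction on the index, and the ultrametric bound for finite sums
`IsUltrametricDist.norm_sum_le_of_forall_le_of_nonneg`.  Specialised to `PadicAlgCl p` this is the
registered stub `stub_coeffInvBound`.
-/

set_option linter.dupNamespace false -- `Summit.Langlands.Langlands` is the mandated namespace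

noncomputable section

namespace Summit.Langlands.Langlands.Theorems.HilbertIntegralOverconvergentIsCongruence

/-- **Integrality of the inverse of an integral power series with constant term `1`** over a
nonarchimedean normed field `K`: if `constantCoeff φ = 1` and `‖coeff n φ‖ ≤ 1` for all `n`, then
`‖coeff n φ⁻¹‖ ≤ 1` for all `n`.  (Recursion `PowerSeries.coeff_inv`: for `n ≠ 0`,
`coeff n φ⁻¹ = -(∑_{i+j=n, j<n} coeff i φ * coeff j φ⁻¹)`, bounded by strong induction and the
ultrametric inequality for finite sums.) [folklore] -/
theorem norm_coeff_inv_le_one {K : Type*} [NormedField K] [IsUltrametricDist K]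
    (φ : PowerSeries K) (h0 : PowerSeries.constantCoeff φ = 1)
    (h : ∀ n, ‖PowerSeries.coeff n φ‖ ≤ 1) (n : ℕ) : ‖PowerSeries.coeff n φ⁻¹‖ ≤ 1 := by
  induction n using Nat.strong_induction_on with
  | _ n ih =>
    rw [PowerSeries.coeff_inv, h0, inv_one]
    split_ifs with hn
    · simp
    · rw [neg_one_mul, norm_neg]
      refine IsUltrametricDist.norm_sum_le_of_forall_le_of_nonneg zero_le_one fun x _ => ?_
      split_ifs with hx
      · rw [norm_mul]
        calc ‖PowerSeries.coeff x.1 φ‖ * ‖PowerSeries.coeff x.2 φ⁻¹‖ ≤ 1 * 1 :=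
              mul_le_mul (h _) (ih _ hx) (norm_nonneg _) zero_le_one
          _ = 1 := one_mul 1
      · simp

/-- **Registered stub `stub_coeffInvBound`** (line `Sketch-ideate-r1-k1`, crux stmt-Langlands-8485).
Over `PadicAlgCl p`: a power series with constant coefficient `1` and all coefficients of norm `≤ 1`
has an inverse with all coefficients of norm `≤ 1`; the case `K = PadicAlgCl p` of
`norm_coeff_inv_le_one` (`PadicAlgCl.isUltrametricDist`). [folklore] -/
theorem stub_coeffInvBound :
    ∀ (p : ℕ) [Fact p.Prime] (φ : PowerSeries (PadicAlgCl p)),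
      PowerSeries.constantCoeff φ = 1 → (∀ n, ‖PowerSeries.coeff n φ‖ ≤ 1) →
      ∀ n : ℕ, ‖PowerSeries.coeff n φ⁻¹‖ ≤ 1 :=
  fun _ _ φ h0 h n => norm_coeff_inv_le_one φ h0 h n

end Summit.Langlands.Langlands.Theorems.HilbertIntegralOverconvergentIsCongruence

end
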